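import Summits.BirchSwinnertonDyer.BirchSwinnertonDyer.Theorems.SignedLowerHalvesKobayashiMainConjectureSmallImageOneSignSwapIntegral
import Summits.BirchSwinnertonDyer.BirchSwinnertonDyer.Theorems.SignedLowerHalvesKobayashiMainConjectureSmallImageCycWindingMuThree
import Summits.BirchSwinnertonDyer.BirchSwinnertonDyer.Theorems.SignedLowerHalvesKobayashiLowerHalfLargeImageSignDefectX7
import Summits.BirchSwinnertonDyer.Rank1Residual.GaloisImage.TorsionIsoImageObstruction
import HarnessLib

/-!
# Route `SignedLowerHalves`, crux L `SmallImageLowerHalfBothSigns` (item stmt-BirchSwinnertonDyer-23599), line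
# `birth_acns` v15, stub `stub_lambdaLowerThree_ns`: the THIRD LOCUS of the `p = 3` λ-stub — the CM-CONGRUENT
# locus — and why, at `p = 3`, the congruence road on it is RIDER-FREE (cell `bsd-ssimc`, width seat
# `bsd-line-slh-p3-w3` gen 7; ROUTE-INDEPENDENT helper, `--supports stmt-BirchSwinnertonDyer-23599 --as helper`;
# THEOREMS ONLY — no definition, no named fact, no `sorry`; closes nothing; BSD is not proved by any of this)

HONEST FRAMING. The registered stub `stub_lambdaLowerThree_ns` (= retired item 23118 `SmallImageLambdaLowerAtThree`
verbatim) asks, at EVERY small-image supersingular X7 pair with `p = 3`, for the `p`-inverted Eisenstein half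
`∃ g h m, char X^ε = (g) ∧ ι(C(3^m)·g) = C ϖ · ι(L₃^ε · h)` at every sign and every datum; class-wide this is the
`λ`-part of Kato's main conjecture on the class and is OPEN MATHEMATICS (verdict of gens 0–6: `stub-blocked`).
Gen 0 typed the two PREPRINT loci on which the text follows from a displayed open binder (Fouquet–Wan Thm. 5.1,
BSTW Thm. 1.3 twist clause: `SmallImageLambdaLowerThreeNsDoor.lambdaShape_of_thm51_OPEN` / `…_of_BSTW13_twist_OPEN`)
and gen 5 proved BOTH loci EMPTY on crux L's domain (`SmallImageLambdaLowerThreeNsTamagawa.not_fwLocus_of_irr_of_not_surj`,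
`…not_twistLocus_of_irr_of_not_surj`). This file types the third locus — the only one of the three that MEETS the
class — and reads the stub there through theorems ALREADY in the tree (cruxes 3/4, seats slh-p1 g4, slh-p3 g4/g8,
k3-c4 g6/g7), composed at `p = 3`:

* **the CM-congruent locus**: small-image pairs `(E, 3)` admitting a CM curve `E′/ℚ`, good supersingular at `3`
  (`a₃(E′) = 0`), with a `Γ_ℚ`-equivariant isomorphism `E[3] ≃ E′[3]`, a depletion set `S₀ ∌ 3` through the bad
  places of both, and ONE displayed INTEGRAL congruence `hMT` of the `S₀`-depleted Mazur–Tate elements of the two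
  conductor-level newforms (`θ_n(f_E)·ιP ≡ c·θ_n(f_{E′})·ιP′ (mod ω_n, 3)` for all `n`, with ANY `c ∈ ℤ₃`; printed
  status recorded in `…SmallImageAnalyticTransfer` / `…OneSignSwap`: Corpuz–Lei 2025 Prop. 4.2 PRE, Vatsal 1999
  canonical periods — NOT asserted here, a hypothesis);
* **why `p = 3` is rider-free** (§1): slh-p3 g4's ONE-SIGN CM ROAD
  `SmallImageOneSignSwapIntegral.exists_kobayashiMainConjecture_of_oneSign_of_cmPartner_intConst` needs, besides the
  published inputs BY NAME and `hMT`, exactly ONE E-side rider `∃ ε₀ L₀, IsSignedPAdicLFunction f_E p ε₀ L₀ ∧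
  HasUnitContent L₀` («one of Pollack's `L^±_3(f_E)` has `μ = 0`»); at `p = 3` this rider is slh-p3 g8's INPUT-FREE
  THEOREM B `SmallImageCycWindingMuThree.exists_sign_hasUnitContent_three_of_isNewformOf` (Vaserstein 1972 + Serre
  1972 Prop. 12 + Pollack Prop. 6.18, all PROVED in the tree). So at a CM-congruent `p = 3` pair:
  `∃ ε, KobayashiMainConjecture W 3 ε` (crux 4's conclusion shape) modulo print + `hMT` ONLY
  (`exists_kobayashiMainConjecture_three_of_mazurTate_congr_of_cmPartner`; general partner satisfying its own main
  conjecture: `…_of_mainConjecture`);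
* **crux L's body there** (§2): the Eisenstein half at the sign of §1 (`kobayashiLowerDivisibility_of_mainConjecture`)
  and slh-p1 g4's sign idleness on X7 (`SignDefect.X7.exists_kobayashiLowerDivisibility_iff_forall`, joint package
  `hJ` by name) give `∀ ε, KobayashiLowerDivisibility W 3 ε` — the signature body of crux L AT THE PAIR
  (`forall_kobayashiLowerDivisibility_three_of_mazurTate_congr_of_cmPartner`);
* **the stub's text there** (§3): a fortiori the registered `p`-inverted λ-shape at every sign and datum, with `m = 0`
  (`lambdaShape_three_of_mazurTate_congr_of_cmPartner`) — the CM-congruent twin of gen 0's two locus theorems, with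
  NO preprint binder: the displayed inputs are PUBLISHED facts by name (`h12`, `h41` RATIONAL clause, `h5`/`h3`,
  B. D. Kim 2009 `h09`/`hKim`, Pollack–Rubin 2004 `hPR`, modularity `hmod`, the joint package `hJ`) + `hMT`.

READING (D-0014; numbers, not adjectives; for the LEAD / pen): (a) on the CM-congruent locus the `p = 3` λ-residue of
crux L is NOT engine territory but ONE Vatsal-type integral congruence per pair (no `μ`/`λ` certificate on either
side, no rank hypothesis, no `Surj`, no rider — THEOREM B pays the rider at `p = 3` and nowhere else); (b) the locus
is the small-image analogue of nothing at large image (partners share `ρ̄`): a CM partner exists iff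
`ρ̄_{E,3} ≅ ρ̄_{A,3} ⊗ χ_d` for a CM curve `A/ℚ` with `3` inert in its CM field (`K ∈ {ℚ(i), ℚ(√−7), ℚ(√−19),
ℚ(√−43), ℚ(√−67), ℚ(√−163)}` up to isogeny) — an infinite (genus-0 twist families `X_{ρ̄}(3)`) but thin sub-locus of
the class; class-wide the verdict `stub-blocked` STANDS; (c) off the locus the same road runs from ANY `3`-congruent
partner whose signed main conjecture is known at every sign (`…_of_mainConjecture`), e.g. a unit-zone partner
(k3-c4's `…AnalyticTransferUnitPartner`). PER PAIR roads, CONDITIONAL on `hMT`; NOT a class theorem; closes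
nothing; BSD / crux L / the stub are NOT proved by any of this.

References: [Kobayashi2003] Thm. 1.2, Thm. 4.1 (p. 8), Thm. 5.2 iv), Thm. 7.4 (p. 13), Conjecture (p. 2);
[PollackRubin2004] Thm. (p. 448); [BDKim2009] Cor. 2.13, Cor. 2.5, Prop. 2.6 (pp. 185–187); [GreenbergVatsal2000]
Thm. (1.4), §3 Rem. 3.4; [PollackWeston2011] Thm. 4.1 (1), Rem. 4.2; [Vaserstein1972SL2] Theorem; [Serre1972] §1.11
Prop. 12; [CorpuzLei2025] Prop. 4.2 (PRE); [Vatsal1999] Thm. 1.10. Memo: crux dir `Lines/birth_acns-MEMO-w3-g7.md`.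
-/

set_option autoImplicit false
-- D-0017: single-problem summit, the namespace repeats the problem name by design.
set_option linter.dupNamespace false
noncomputable section

open scoped Classical MatrixGroups ModularForm BigOperators

open CongruenceSubgroup WeierstrassCurve NumberField IsDedekindDomain
  Literature.NumberTheory.EllipticCurves
  Literature.NumberTheory.EllipticCurves.ModularForms
  Literature.NumberTheory.EllipticCurves.Rank1Residual
  Literature.NumberTheory.EllipticCurves.Rank1Residual.Typed
  Literature.NumberTheory.EllipticCurves.Kobayashi2003 ZpExtension
  Literature.NumberTheory.EllipticCurves.GreenbergVatsal2000
  Literature.NumberTheory.EllipticCurves.BDKim2009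
  Literature.NumberTheory.EllipticCurves.Sprung2017
  Summit.BirchSwinnertonDyer.Rank1Residual.X1.MuLambda
  Summit.BirchSwinnertonDyer.Rank1Residual.Supersingular
  Summit.BirchSwinnertonDyer.BirchSwinnertonDyer.Theorems.SmallImageOneSignSwapIntegral
  Summit.BirchSwinnertonDyer.BirchSwinnertonDyer.Theorems.SmallImageCycWindingMuThree

namespace Summit.BirchSwinnertonDyer.BirchSwinnertonDyer.Theorems.SmallImageLambdaLowerThreeNsCongruence

/-! ### §1 At `p = 3` the one-sign CM road is rider-free: THEOREM B pays the E-side rider -/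

section RiderFree

variable (p : ℕ) [Fact p.Prime]

/-- **The E-side rider at `p = 3`, INPUT-FREE, in the line's binder shape** (`(p : ℕ) [Fact p.Prime]`, `p = 3 →`):
for `W/ℚ` globally minimal with good reduction at `p = 3` and `a₃ = 0`, and ANY form `f` with `IsNewformOf W f`,
one of Pollack's signed `3`-adic `L`-functions of `f` has unit content:
`∃ ε₀ L₀, IsSignedPAdicLFunction f p ε₀ L₀ ∧ HasUnitContent L₀`. This is slh-p3 g8's THEOREM B
`SmallImageCycWindingMuThree.exists_sign_hasUnitContent_three_of_isNewformOf` (Vaserstein + Serre Prop. 12 +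
Pollack Prop. 6.18, all proved in the tree) transported along `p = 3`; no image or CM hypothesis.
[cite: PollackWeston2011, Thm. 4.1 (1), Rem. 4.2] [cite: Vaserstein1972SL2, Theorem] [cite: Serre1972, §1.11 Prop. 12] -/
theorem exists_sign_isSignedPAdicLFunction_hasUnitContent_three (hp3 : p = 3)
    {W : WeierstrassCurve ℚ} [W.IsElliptic] [W.IsGloballyMinimal]
    (hgood : W.HasGoodReductionAtPrime p) (hap : W.frobeniusTrace p = 0)
    {N : ℕ} [NeZero N] (f : CuspForm (Gamma0 N) 2) (hf : IsNewformOf W f) :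
    ∃ (ε₀ : ℤˣ) (L₀ : IwasawaAlgebra p), IsSignedPAdicLFunction f p ε₀ L₀ ∧ HasUnitContent L₀ := by
  subst hp3
  exact exists_sign_hasUnitContent_three_of_isNewformOf f hf hgood hap

/-- **`p = 3` is odd** (bookkeeping for the road's `p ≠ 2` binder). [folklore] -/
theorem ne_two_of_eq_three {q : ℕ} (hq : q = 3) : q ≠ 2 := by omega

/-- **Congruence road at `p = 3`, general partner, RIDER-FREE: `∃ ε, KobayashiMainConjecture W 3 ε` at a
`3`-congruent pair from the PARTNER's main conjecture at every sign.** Inputs BY NAME (published): Kobayashi 2003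
Thm. 1.2 (`h12`), Thm. 4.1 RATIONAL clause (`h41`, no image hypothesis), the period-unit facts (`h5`, `h3`),
B. D. Kim 2009 Cor. 2.13 `μ`-half (`h09`) and `λ`-half ∘ Cor. 2.5 ∘ Prop. 2.6 (`hKim`), modularity (`hmod`, the
partner's period ratio); per pair: `p = 3` good for `E = W` with `a₃ = 0`, the conductor-level newform `f₀`, a
partner `E′ = W′` good at `3` with `a₃(E′) = 0` and a `Γ_ℚ`-iso `E[3] ≃ E′[3]` (`he`), its newform `f₀′`, the
partner's main conjecture at EVERY sign (`hMC′`), a finite `S₀ ∌ 3` containing the bad places of both, ANY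
constant `c ∈ ℤ₃` and the displayed integral Mazur–Tate congruence `hMT`. The E-side rider of slh-p3 g4's
`SmallImageOneSignSwapIntegral.kobayashiMainConjecture_of_oneSign_of_mazurTate_congr_of_mainConjecture_intConst`
is DISCHARGED by THEOREM B (`exists_sign_isSignedPAdicLFunction_hasUnitContent_three`); its sign `ε₀` is the sign
of the conclusion. PER PAIR; CONDITIONAL on `hMT` and `hMC′`; closes nothing.
[cite: GreenbergVatsal2000, Thm. (1.4) and §3 Remark 3.4] [cite: Kobayashi2003, Thm. 1.2, Thm. 4.1 (p. 8) and Conjecture (p. 2)]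
[cite: BDKim2009, Cor. 2.13, Cor. 2.5 and Prop. 2.6 (pp. 185–187)] [cite: PollackWeston2011, Thm. 4.1 (1), Rem. 4.2] -/
theorem exists_kobayashiMainConjecture_three_of_mazurTate_congr_of_mainConjecture (hp3 : p = 3)
    (h12 : Kobayashi2003.thm12_signedSelmerDual_finite_torsion)
    (h41 : Kobayashi2003.thm41_signedCharIdeal_divisibility)
    (h5 : realPeriodRat_eq_unit_mul_plusPeriod) (h3 : realPeriodRat_eq_unit_mul_plusPeriod_three)
    (h09 : cor213_signedMu_eq_zero_iff_of_torsionIso)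
    (hKim : BDKim2009.cor213_signedLambda_add_sum_delta_eq_of_torsionIso)
    (hmod : nonempty_modularParametrizationData)
    {W : WeierstrassCurve ℚ} [W.IsElliptic] [W.IsGloballyMinimal]
    (hgood : W.HasGoodReductionAtPrime p) (hap : W.frobeniusTrace p = 0)
    [NeZero (W.conductorNorm ℤ)] {f₀ : CuspForm (Gamma0 (W.conductorNorm ℤ)) 2} (hf₀ : IsNewformOf W f₀)
    {W' : WeierstrassCurve ℚ} [W'.IsElliptic] [W'.IsGloballyMinimal]
    (hgood' : W'.HasGoodReductionAtPrime p) (hap' : W'.frobeniusTrace p = 0)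
    (he : ∃ e : geomTorsion W (p : ℤ) ≃+ geomTorsion W' (p : ℤ),
      ∀ (σ : Field.absoluteGaloisGroup ℚ) (P : geomTorsion W (p : ℤ)), e (σ • P) = σ • e P)
    [NeZero (W'.conductorNorm ℤ)] {f₀' : CuspForm (Gamma0 (W'.conductorNorm ℤ)) 2}
    (hf₀' : IsNewformOf W' f₀') (hMC' : ∀ ε : ℤˣ, KobayashiMainConjecture W' p ε)
    (S₀ : Finset (HeightOneSpectrum (𝓞 ℚ))) (hS₀ : ∀ v ∈ S₀, ((p : ℕ) : 𝓞 ℚ) ∉ v.asIdeal)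
    (hS₀W : ∀ v : HeightOneSpectrum (𝓞 ℚ), ¬ W.HasGoodReductionAt v → v ∈ S₀)
    (hS₀W' : ∀ v : HeightOneSpectrum (𝓞 ℚ), ¬ W'.HasGoodReductionAt v → v ∈ S₀)
    (c : ℤ_[p])
    (hMT : ∀ n : ℕ, ∃ q r : IwasawaAlgebra p,
      ((mazurTateElement f₀ p n).map (algebraMap ℚ ℚ_[p]) : PowerSeries ℚ_[p]) *
            iwasawaToPowerSeries p (eulerFactorProduct W p S₀) -
          iwasawaToPowerSeries p (PowerSeries.C c) *
            (((mazurTateElement f₀' p n).map (algebraMap ℚ ℚ_[p]) : PowerSeries ℚ_[p]) *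
              iwasawaToPowerSeries p (eulerFactorProduct W' p S₀)) =
        iwasawaToPowerSeries p
          (toIwasawa p (cyclotomicOmega p n) * q + PowerSeries.C (p : ℤ_[p]) * r)) :
    ∃ ε : ℤˣ, KobayashiMainConjecture W p ε := by
  obtain ⟨ε₀, L₀, hL₀, hL₀U⟩ :=
    exists_sign_isSignedPAdicLFunction_hasUnitContent_three p hp3 hgood hap f₀ hf₀
  exact ⟨ε₀, kobayashiMainConjecture_of_oneSign_of_mazurTate_congr_of_mainConjecture_intConst h12 h41 h5 h3 h09
    hKim hmod (ne_two_of_eq_three hp3) hgood hap hf₀ hL₀ hL₀U hgood' hap' he hf₀' (hMC' ε₀) S₀ hS₀ hS₀W hS₀W'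
    c hMT⟩

/-- **CM-CONGRUENT LOCUS at `p = 3`, RIDER-FREE: `∃ ε, KobayashiMainConjecture W 3 ε` (crux 4's conclusion shape)
modulo print + ONE displayed integral Mazur–Tate congruence.** As
`exists_kobayashiMainConjecture_three_of_mazurTate_congr_of_mainConjecture` with a CM partner `W′` (`W′.HasCM`,
`GoodSS W′ 3`, `a₃(W′) = 0`), whose signed main conjecture is Pollack–Rubin 2004 BY NAME (`hPR`). = slh-p3 g4's
`exists_kobayashiMainConjecture_of_oneSign_of_cmPartner_intConst` with its E-side rider paid by THEOREM B: at
`p = 3` NOTHING per pair is displayed beyond the partner data, `S₀`, `c ∈ ℤ₃` (ANY) and `hMT`. PER PAIR; CONDITIONAL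
on `hMT`; NOT a class theorem; closes nothing. [cite: PollackRubin2004, Theorem (p. 448) = Thm. 7.3]
[cite: GreenbergVatsal2000, Thm. (1.4) and §3 Remark 3.4] [cite: BDKim2009, Cor. 2.13 (p. 187)]
[cite: PollackWeston2011, Thm. 4.1 (1), Rem. 4.2] [cite: Vaserstein1972SL2, Theorem] -/
theorem exists_kobayashiMainConjecture_three_of_mazurTate_congr_of_cmPartner (hp3 : p = 3)
    (h12 : Kobayashi2003.thm12_signedSelmerDual_finite_torsion)
    (h41 : Kobayashi2003.thm41_signedCharIdeal_divisibility)
    (h5 : realPeriodRat_eq_unit_mul_plusPeriod) (h3 : realPeriodRat_eq_unit_mul_plusPeriod_three)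
    (h09 : cor213_signedMu_eq_zero_iff_of_torsionIso)
    (hKim : BDKim2009.cor213_signedLambda_add_sum_delta_eq_of_torsionIso)
    (hPR : PollackRubin2004.mainTheorem_signedCharIdeal_eq_of_cm)
    (hmod : nonempty_modularParametrizationData)
    {W : WeierstrassCurve ℚ} [W.IsElliptic] [W.IsGloballyMinimal]
    (hgood : W.HasGoodReductionAtPrime p) (hap : W.frobeniusTrace p = 0)
    [NeZero (W.conductorNorm ℤ)] {f₀ : CuspForm (Gamma0 (W.conductorNorm ℤ)) 2} (hf₀ : IsNewformOf W f₀)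
    {W' : WeierstrassCurve ℚ} [W'.IsElliptic] [W'.IsGloballyMinimal]
    (hcm' : W'.HasCM) (hss' : GoodSS W' p) (hap' : W'.frobeniusTrace p = 0)
    (he : ∃ e : geomTorsion W (p : ℤ) ≃+ geomTorsion W' (p : ℤ),
      ∀ (σ : Field.absoluteGaloisGroup ℚ) (P : geomTorsion W (p : ℤ)), e (σ • P) = σ • e P)
    [NeZero (W'.conductorNorm ℤ)] {f₀' : CuspForm (Gamma0 (W'.conductorNorm ℤ)) 2}
    (hf₀' : IsNewformOf W' f₀')
    (S₀ : Finset (HeightOneSpectrum (𝓞 ℚ))) (hS₀ : ∀ v ∈ S₀, ((p : ℕ) : 𝓞 ℚ) ∉ v.asIdeal)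
    (hS₀W : ∀ v : HeightOneSpectrum (𝓞 ℚ), ¬ W.HasGoodReductionAt v → v ∈ S₀)
    (hS₀W' : ∀ v : HeightOneSpectrum (𝓞 ℚ), ¬ W'.HasGoodReductionAt v → v ∈ S₀)
    (c : ℤ_[p])
    (hMT : ∀ n : ℕ, ∃ q r : IwasawaAlgebra p,
      ((mazurTateElement f₀ p n).map (algebraMap ℚ ℚ_[p]) : PowerSeries ℚ_[p]) *
            iwasawaToPowerSeries p (eulerFactorProduct W p S₀) -
          iwasawaToPowerSeries p (PowerSeries.C c) *
            (((mazurTateElement f₀' p n).map (algebraMap ℚ ℚ_[p]) : PowerSeries ℚ_[p]) *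
              iwasawaToPowerSeries p (eulerFactorProduct W' p S₀)) =
        iwasawaToPowerSeries p
          (toIwasawa p (cyclotomicOmega p n) * q + PowerSeries.C (p : ℤ_[p]) * r)) :
    ∃ ε : ℤˣ, KobayashiMainConjecture W p ε :=
  exists_kobayashiMainConjecture_of_oneSign_of_cmPartner_intConst h12 h41 h5 h3 h09 hKim hPR hmod p W
    (ne_two_of_eq_three hp3) hgood hap f₀ hf₀
    (exists_sign_isSignedPAdicLFunction_hasUnitContent_three p hp3 hgood hap f₀ hf₀)
    W' hcm' hss' hap' he f₀' hf₀' S₀ hS₀ hS₀W hS₀W' c hMT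

end RiderFree

/-! ### §2 Crux L's body at a CM-congruent `p = 3` pair: the sign is idle on X7 -/

section CruxL

variable (W : WeierstrassCurve ℚ) [W.IsElliptic] [W.IsGloballyMinimal] (p : ℕ) [Fact p.Prime]

/-- **Crux L (`SmallImageLowerHalfBothSigns`) AT A `3`-CONGRUENT X7 PAIR, general partner:
`∀ ε, KobayashiLowerDivisibility W 3 ε` modulo print + the partner's main conjecture + `hMT`.** On class X7 at
`p = 3` with `a₃ = 0` (crux L's domain minus its idle `¬CM` / `¬Surj` binders): §1 gives Kobayashi's main conjecture
at ONE sign, hence its Eisenstein half there (`kobayashiLowerDivisibility_of_mainConjecture`), and slh-p1 g4's sign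
idleness on X7 (`SignDefect.X7.exists_kobayashiLowerDivisibility_iff_forall`: the `±` four-term sequences start at
the same `𝐇¹/Z` of Kobayashi's JOINT Coleman–Kato package, `hJ` = `Kobayashi2003.thm62_63_73_signedColemanKato_zetaJoint`
BY NAME) gives it at EVERY sign. PER PAIR; CONDITIONAL on `hMT` and `hMC′`; closes nothing.
[cite: Kobayashi2003, Thm. 5.2 iv) (p. 9), Thm. 7.4 and its proof (p. 13), Conjecture (p. 2)]
[cite: GreenbergVatsal2000, Thm. (1.4) and §3 Remark 3.4] [cite: BDKim2009, Cor. 2.13, Cor. 2.5 and Prop. 2.6 (pp. 185–187)] -/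
theorem forall_kobayashiLowerDivisibility_three_of_mazurTate_congr_of_mainConjecture (hp3 : p = 3)
    (h12 : Kobayashi2003.thm12_signedSelmerDual_finite_torsion)
    (h41 : Kobayashi2003.thm41_signedCharIdeal_divisibility)
    (h5 : realPeriodRat_eq_unit_mul_plusPeriod) (h3 : realPeriodRat_eq_unit_mul_plusPeriod_three)
    (h09 : cor213_signedMu_eq_zero_iff_of_torsionIso)
    (hKim : BDKim2009.cor213_signedLambda_add_sum_delta_eq_of_torsionIso)
    (hmod : nonempty_modularParametrizationData)
    (hJ : Kobayashi2003.thm62_63_73_signedColemanKato_zetaJoint)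
    (hX : ClassX7 W p) (hap : W.frobeniusTrace p = 0)
    [NeZero (W.conductorNorm ℤ)] {f₀ : CuspForm (Gamma0 (W.conductorNorm ℤ)) 2} (hf₀ : IsNewformOf W f₀)
    {W' : WeierstrassCurve ℚ} [W'.IsElliptic] [W'.IsGloballyMinimal]
    (hgood' : W'.HasGoodReductionAtPrime p) (hap' : W'.frobeniusTrace p = 0)
    (he : ∃ e : geomTorsion W (p : ℤ) ≃+ geomTorsion W' (p : ℤ),
      ∀ (σ : Field.absoluteGaloisGroup ℚ) (P : geomTorsion W (p : ℤ)), e (σ • P) = σ • e P)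
    [NeZero (W'.conductorNorm ℤ)] {f₀' : CuspForm (Gamma0 (W'.conductorNorm ℤ)) 2}
    (hf₀' : IsNewformOf W' f₀') (hMC' : ∀ ε : ℤˣ, KobayashiMainConjecture W' p ε)
    (S₀ : Finset (HeightOneSpectrum (𝓞 ℚ))) (hS₀ : ∀ v ∈ S₀, ((p : ℕ) : 𝓞 ℚ) ∉ v.asIdeal)
    (hS₀W : ∀ v : HeightOneSpectrum (𝓞 ℚ), ¬ W.HasGoodReductionAt v → v ∈ S₀)
    (hS₀W' : ∀ v : HeightOneSpectrum (𝓞 ℚ), ¬ W'.HasGoodReductionAt v → v ∈ S₀)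
    (c : ℤ_[p])
    (hMT : ∀ n : ℕ, ∃ q r : IwasawaAlgebra p,
      ((mazurTateElement f₀ p n).map (algebraMap ℚ ℚ_[p]) : PowerSeries ℚ_[p]) *
            iwasawaToPowerSeries p (eulerFactorProduct W p S₀) -
          iwasawaToPowerSeries p (PowerSeries.C c) *
            (((mazurTateElement f₀' p n).map (algebraMap ℚ ℚ_[p]) : PowerSeries ℚ_[p]) *
              iwasawaToPowerSeries p (eulerFactorProduct W' p S₀)) =
        iwasawaToPowerSeries p
          (toIwasawa p (cyclotomicOmega p n) * q + PowerSeries.C (p : ℤ_[p]) * r)) :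
    ∀ ε : ℤˣ, KobayashiLowerDivisibility W p ε := by
  obtain ⟨ε₀, hMC⟩ := exists_kobayashiMainConjecture_three_of_mazurTate_congr_of_mainConjecture p hp3 h12 h41 h5
    h3 h09 hKim hmod hX.1.1 hap hf₀ hgood' hap' he hf₀' hMC' S₀ hS₀ hS₀W hS₀W' c hMT
  exact (SignDefect.X7.exists_kobayashiLowerDivisibility_iff_forall W p h12 h5 h3 hJ (ne_two_of_eq_three hp3) hX
    hap).mp ⟨ε₀, kobayashiLowerDivisibility_of_mainConjecture hMC⟩

/-- **Crux L AT A CM-CONGRUENT X7 PAIR WITH `p = 3`: `∀ ε, KobayashiLowerDivisibility W 3 ε` — the signature body of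
`SignedLowerHalves.SmallImageLowerHalfBothSigns` at the pair — modulo PUBLISHED facts by name + ONE displayed integral
Mazur–Tate congruence `hMT`.** Displayed: `h12`, `h41` (rational clause), `h5`/`h3`, `h09`/`hKim` (B. D. Kim 2009),
`hPR` (Pollack–Rubin 2004), `hmod`, `hJ` (joint package); per pair: class X7 at `p = 3`, `a₃ = 0`, the newform `f₀`,
a CM partner `W′` (good supersingular at `3`, `a₃ = 0`, `Γ_ℚ`-iso `E[3] ≃ E′[3]`), its newform, `S₀ ∌ 3`, ANY `c ∈ ℤ₃`,
`hMT`. NO rider, NO certificate, NO `Surj`/`¬Surj`, NO rank hypothesis: the rider is THEOREM B (§1), the sign is idle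
(slh-p1 g4). The CM-congruent twin of gen 0's locus theorems, with NO preprint binder. PER PAIR; CONDITIONAL on `hMT`;
NOT a class theorem about crux L; closes nothing. [cite: PollackRubin2004, Theorem (p. 448) = Thm. 7.3]
[cite: Kobayashi2003, Thm. 5.2 iv) (p. 9), Thm. 7.4 and its proof (p. 13), Conjecture (p. 2)]
[cite: BDKim2009, Cor. 2.13, Cor. 2.5 and Prop. 2.6 (pp. 185–187)] [cite: PollackWeston2011, Thm. 4.1 (1), Rem. 4.2] -/
theorem forall_kobayashiLowerDivisibility_three_of_mazurTate_congr_of_cmPartner (hp3 : p = 3)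
    (h12 : Kobayashi2003.thm12_signedSelmerDual_finite_torsion)
    (h41 : Kobayashi2003.thm41_signedCharIdeal_divisibility)
    (h5 : realPeriodRat_eq_unit_mul_plusPeriod) (h3 : realPeriodRat_eq_unit_mul_plusPeriod_three)
    (h09 : cor213_signedMu_eq_zero_iff_of_torsionIso)
    (hKim : BDKim2009.cor213_signedLambda_add_sum_delta_eq_of_torsionIso)
    (hPR : PollackRubin2004.mainTheorem_signedCharIdeal_eq_of_cm)
    (hmod : nonempty_modularParametrizationData)
    (hJ : Kobayashi2003.thm62_63_73_signedColemanKato_zetaJoint)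
    (hX : ClassX7 W p) (hap : W.frobeniusTrace p = 0)
    [NeZero (W.conductorNorm ℤ)] {f₀ : CuspForm (Gamma0 (W.conductorNorm ℤ)) 2} (hf₀ : IsNewformOf W f₀)
    {W' : WeierstrassCurve ℚ} [W'.IsElliptic] [W'.IsGloballyMinimal]
    (hcm' : W'.HasCM) (hss' : GoodSS W' p) (hap' : W'.frobeniusTrace p = 0)
    (he : ∃ e : geomTorsion W (p : ℤ) ≃+ geomTorsion W' (p : ℤ),
      ∀ (σ : Field.absoluteGaloisGroup ℚ) (P : geomTorsion W (p : ℤ)), e (σ • P) = σ • e P)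
    [NeZero (W'.conductorNorm ℤ)] {f₀' : CuspForm (Gamma0 (W'.conductorNorm ℤ)) 2}
    (hf₀' : IsNewformOf W' f₀')
    (S₀ : Finset (HeightOneSpectrum (𝓞 ℚ))) (hS₀ : ∀ v ∈ S₀, ((p : ℕ) : 𝓞 ℚ) ∉ v.asIdeal)
    (hS₀W : ∀ v : HeightOneSpectrum (𝓞 ℚ), ¬ W.HasGoodReductionAt v → v ∈ S₀)
    (hS₀W' : ∀ v : HeightOneSpectrum (𝓞 ℚ), ¬ W'.HasGoodReductionAt v → v ∈ S₀)
    (c : ℤ_[p])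
    (hMT : ∀ n : ℕ, ∃ q r : IwasawaAlgebra p,
      ((mazurTateElement f₀ p n).map (algebraMap ℚ ℚ_[p]) : PowerSeries ℚ_[p]) *
            iwasawaToPowerSeries p (eulerFactorProduct W p S₀) -
          iwasawaToPowerSeries p (PowerSeries.C c) *
            (((mazurTateElement f₀' p n).map (algebraMap ℚ ℚ_[p]) : PowerSeries ℚ_[p]) *
              iwasawaToPowerSeries p (eulerFactorProduct W' p S₀)) =
        iwasawaToPowerSeries p
          (toIwasawa p (cyclotomicOmega p n) * q + PowerSeries.C (p : ℤ_[p]) * r)) :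
    ∀ ε : ℤˣ, KobayashiLowerDivisibility W p ε :=
  forall_kobayashiLowerDivisibility_three_of_mazurTate_congr_of_mainConjecture W p hp3 h12 h41 h5 h3 h09 hKim hmod
    hJ hX hap hf₀ hss'.1 hap' he hf₀'
    (kobayashiMainConjecture_of_pollackRubin_of_goodSS W' p hPR hcm' (ne_two_of_eq_three hp3) hss') S₀ hS₀ hS₀W
    hS₀W' c hMT

end CruxL

/-! ### §3 The registered stub's text at a CM-congruent `p = 3` pair (the third locus; `m = 0`) -/

section StubText

variable (W : WeierstrassCurve ℚ) [W.IsElliptic] [W.IsGloballyMinimal] (p : ℕ) [Fact p.Prime]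

/-- **THE CM-CONGRUENT LOCUS OF `stub_lambdaLowerThree_ns`.** At a small-image supersingular X7 pair with `p = 3`
(the stub's own binders `p = 3`, `ClassX7`, `¬CM`, `a₃ = 0`, `¬Surj` — the last two image binders idle) carrying a
CM partner `W′` (good supersingular at `3`, `a₃ = 0`, `Γ_ℚ`-iso `E[3] ≃ E′[3]`, newform `f₀′`), a depletion set
`S₀ ∌ 3`, ANY `c ∈ ℤ₃` and the displayed integral Mazur–Tate congruence `hMT`, the stub's registered `p`-inverted
λ-shape holds for EVERY sign, cyclotomic datum, newform, period ratio, Pollack pair and dual datum — indeed with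
`m = 0` (the INTEGRAL Eisenstein half, §2). Published inputs BY NAME only (`h12`, `h41` rational, `h5`/`h3`,
`h09`/`hKim`, `hPR`, `hmod`, `hJ`); NO preprint binder (contrast gen 0's `lambdaShape_of_thm51_OPEN` /
`…_of_BSTW13_twist_OPEN`, whose loci are EMPTY on the class by gen 5). PER PAIR; CONDITIONAL on `hMT`; the stub
(class-wide) is NOT proved; closes nothing. [cite: Kobayashi2003, Conjecture (p. 2), Thm. 4.1 (p. 8), Thm. 7.4 (p. 13)]
[cite: PollackRubin2004, Theorem (p. 448) = Thm. 7.3] [cite: BDKim2009, Cor. 2.13, Cor. 2.5 and Prop. 2.6 (pp. 185–187)]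
[cite: GreenbergVatsal2000, Thm. (1.4) and §3 Remark 3.4] -/
theorem lambdaShape_three_of_mazurTate_congr_of_cmPartner (hp3 : p = 3)
    (h12 : Kobayashi2003.thm12_signedSelmerDual_finite_torsion)
    (h41 : Kobayashi2003.thm41_signedCharIdeal_divisibility)
    (h5 : realPeriodRat_eq_unit_mul_plusPeriod) (h3 : realPeriodRat_eq_unit_mul_plusPeriod_three)
    (h09 : cor213_signedMu_eq_zero_iff_of_torsionIso)
    (hKim : BDKim2009.cor213_signedLambda_add_sum_delta_eq_of_torsionIso)
    (hPR : PollackRubin2004.mainTheorem_signedCharIdeal_eq_of_cm)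
    (hmod : nonempty_modularParametrizationData)
    (hJ : Kobayashi2003.thm62_63_73_signedColemanKato_zetaJoint)
    (hX : ClassX7 W p) (_hcm : ¬ W.HasCM) (hap : W.frobeniusTrace p = 0) (_hns : ¬ Surj W p)
    [NeZero (W.conductorNorm ℤ)] {f₀ : CuspForm (Gamma0 (W.conductorNorm ℤ)) 2} (hf₀ : IsNewformOf W f₀)
    {W' : WeierstrassCurve ℚ} [W'.IsElliptic] [W'.IsGloballyMinimal]
    (hcm' : W'.HasCM) (hss' : GoodSS W' p) (hap' : W'.frobeniusTrace p = 0)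
    (he : ∃ e : geomTorsion W (p : ℤ) ≃+ geomTorsion W' (p : ℤ),
      ∀ (σ : Field.absoluteGaloisGroup ℚ) (P : geomTorsion W (p : ℤ)), e (σ • P) = σ • e P)
    [NeZero (W'.conductorNorm ℤ)] {f₀' : CuspForm (Gamma0 (W'.conductorNorm ℤ)) 2}
    (hf₀' : IsNewformOf W' f₀')
    (S₀ : Finset (HeightOneSpectrum (𝓞 ℚ))) (hS₀ : ∀ v ∈ S₀, ((p : ℕ) : 𝓞 ℚ) ∉ v.asIdeal)
    (hS₀W : ∀ v : HeightOneSpectrum (𝓞 ℚ), ¬ W.HasGoodReductionAt v → v ∈ S₀)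
    (hS₀W' : ∀ v : HeightOneSpectrum (𝓞 ℚ), ¬ W'.HasGoodReductionAt v → v ∈ S₀)
    (c : ℤ_[p])
    (hMT : ∀ n : ℕ, ∃ q r : IwasawaAlgebra p,
      ((mazurTateElement f₀ p n).map (algebraMap ℚ ℚ_[p]) : PowerSeries ℚ_[p]) *
            iwasawaToPowerSeries p (eulerFactorProduct W p S₀) -
          iwasawaToPowerSeries p (PowerSeries.C c) *
            (((mazurTateElement f₀' p n).map (algebraMap ℚ ℚ_[p]) : PowerSeries ℚ_[p]) *
              iwasawaToPowerSeries p (eulerFactorProduct W' p S₀)) =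
        iwasawaToPowerSeries p
          (toIwasawa p (cyclotomicOmega p n) * q + PowerSeries.C (p : ℤ_[p]) * r))
    (ε : ℤˣ) (κ : ZpExtension ℚ p) (γ : Field.absoluteGaloisGroup ℚ) (hκ : κ.IsCyclotomic)
    (hγ : κ.IsTopGenerator γ) (hγ' : IsCyclotomicVariable p γ) (f : CuspForm (Gamma0 (W.conductorNorm ℤ)) 2)
    (hf : IsNewformOf W f) (ϖ : ℚ) (hϖ : (ϖ : ℝ) * W.realPeriodRat = plusPeriod f)
    (Lplus Lminus : IwasawaAlgebra p) (hPP : IsPollackPair f p Lplus Lminus) (D : SignedSelmerDualData W κ γ ε) :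
    ∃ (g h : IwasawaAlgebra p) (m : ℕ), D.charIdeal = Ideal.span {g} ∧
      iwasawaToPowerSeries p (PowerSeries.C ((p : ℤ_[p]) ^ m) * g) =
        PowerSeries.C (ϖ : ℚ_[p]) * iwasawaToPowerSeries p (kobayashiL ε Lplus Lminus * h) := by
  obtain ⟨g, h', hg, hι⟩ := forall_kobayashiLowerDivisibility_three_of_mazurTate_congr_of_cmPartner W p hp3 h12 h41
    h5 h3 h09 hKim hPR hmod hJ hX hap hf₀ hcm' hss' hap' he hf₀' S₀ hS₀ hS₀W hS₀W' c hMT ε κ γ hκ hγ hγ' f hf ϖ hϖ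
    Lplus Lminus hPP D
  exact ⟨g, h', 0, hg, by rw [pow_zero, map_one, one_mul]; exact hι⟩

end StubText

/-! ### §4 The locus never leaves the small-image class: every `3`-congruent partner is again small-image and
non-semistable (so the imported main conjecture is Pollack–Rubin's or a unit-zone one, never a big-image /
semistable theorem) -/

section Locus

variable (W : WeierstrassCurve ℚ) [W.IsElliptic] [W.IsGloballyMinimal] (p : ℕ) [Fact p.Prime]

/-- **Partners of a small-image X7 pair are small-image and NON-semistable.** On crux L's domain (`p` odd, class
X7, `a_p = 0`, `ρ̄_{E,p}` NOT onto) every curve `E′` with a `Γ_ℚ`-equivariant isomorphism `E[p] ≃ E′[p]` has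
`E′[p]` irreducible, `ρ̄_{E′,p}` NOT onto, and is NOT semistable: irreducibility and non-surjectivity transport
along the congruence (Greenberg–Vatsal; n1011's `GaloisImage.irr_and_not_surj_of_torsionIso`), and a semistable
curve with irreducible `E′[p]` has surjective `ρ̄` (Serre Prop. 21, tree `surj_of_irr_of_semistable`). So the
congruence road of §§1–3 can only import a main conjecture valid AT SMALL IMAGE AND NON-SQUARE-FREE LEVEL —
Pollack–Rubin's (CM partner) or a unit-zone partner's — never crux 2's / crux 3's / BSTW's semistable or
big-image theorems; consistent with gen 5's emptiness of the FW and BSTW-twist loci. [cite: Serre1972, §2.4 Prop. 15 and §5.4 Prop. 21]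
[cite: GreenbergVatsal2000, §2 (congruent curves)] -/
theorem partner_irr_not_surj_not_semistable (hp2 : p ≠ 2) (hX : ClassX7 W p) (hap : W.frobeniusTrace p = 0)
    (hns : ¬ Surj W p) {W' : WeierstrassCurve ℚ} [W'.IsElliptic] [W'.IsGloballyMinimal]
    (he : ∃ e : geomTorsion W (p : ℤ) ≃+ geomTorsion W' (p : ℤ),
      ∀ (σ : Field.absoluteGaloisGroup ℚ) (P : geomTorsion W (p : ℤ)), e (σ • P) = σ • e P) :
    Irr W' p ∧ ¬ Surj W' p ∧ ¬ Semistable W' := by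
  obtain ⟨e, he⟩ := he
  have hirr : Irr W p :=
    hasIrreducibleModPGaloisRep_of_dvd_frobeniusTrace W p hp2
      (W.not_dvd_minimalDiscriminantInt_of_hasGoodReductionAtPrime' p hX.1.1) (by rw [hap]; exact dvd_zero _)
  obtain ⟨hirr', hns'⟩ :=
    Summit.BirchSwinnertonDyer.Rank1Residual.GaloisImage.irr_and_not_surj_of_torsionIso e he hirr hns
  exact ⟨hirr', hns', fun hsst ↦ hns' (surj_of_irr_of_semistable W' p hirr' hsst)⟩

end Locus

end Summit.BirchSwinnertonDyer.BirchSwinnertonDyer.Theorems.SmallImageLambdaLowerThreeNsCongruence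

end
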